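import Summits.QuantumFields.BalabanUV.Beta.CompositeCorrectorForms

/-!
# `BalabanUV.Beta.CompositeCorrectorLinear` — binder row D1, work item K-U3d leaf L2 (Form level, part 1 of 2): **THE COMPOSITE AVERAGE, THE DEFECT
# POTENTIAL AND THE (a1*)_m CORRECTORS ARE ℝ-LINEAR IN THE FIELD** (`_add ∕ _smul ∕ _zero ∕ _sum_smul`, pointwise forms `corrPsi_apply ∕ corrPhi_apply`)
# (β sub-cell, BINDER-OWNERS row D1; cross-lane idle seat t4-ne9-formalise-leaf-06 gen 32 on the row-D1 OWNER an2-g24's leaf list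
# `HOME/b2b-balaban-beta-an2/gen24/K-U3d-LEAVES.v1.3205b2870f6492d5.md` §L2; over L1 `CompositeCorrectorForms` p241443 BY NAME)

HONEST FRAMING (cell charter, verbatim): «discharging BetaPertH makes Balaban's UV stability UNCONDITIONAL — a real
constructive-QFT result; it is NOT the continuum limit and NOT the Clay problem.»
HONEST DEPENDENCY: continuum YM on T⁴ ⇐ BetaPertH ∧ nine spine estimates (0/9 proved); BetaPertH ⇐ (D1) ∧ (D4) ∧ CAP+tail;
G-an2-4 gates asym, D1 and NE2/3/4.
ABSOLUTE RULE (cell, verbatim): «No internally-minted statement may enter as a cited fact. Every hypothesis is either kernel-proved in this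
package or a verbatim quotation of a PUBLISHED theorem with page reference. The manuscript(s) under audit are NOT citable for their own
disputed steps — they are the thing under adjudication; programme-internal (2001/route/tribunal) claims are never citable.»
NOTHING below is cited: no `[cite: …]`, no `Prop` fact, no definition.  [folklore] finite-sum algebra over the cell's OWN typed objects BY NAME: an1's
`AveragingContours.axial ∕ segUp ∕ rev` and `AveragingContoursRooted.linAvgAt ∕ treeGaugeAt ∕ gammaCAt`, the an2 lineage's naturality lemmas
`AxialProjector.axial_map ∕ segUp_map` (letterwise transport along `c • · : ℝ →+ ℝ`), an3-g37's `CompositeAveragingCoarseExact.compLinAvgAt ∕ compDefectAt`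
(`_succ` clauses), the row-D1 owner's L1 `CompositeCorrectorForms.corrPhi ∕ corrPsi ∕ ext` (`compLinAvgAt_sub`, `compDefectAt_sub` — additivity is their
corollary; homogeneity is the letterwise transport).  It asserts nothing about Bałaban's non-linear averages beyond their typed linearisations.

WHY (K-U3d leaf L2, the APPLY BRIDGE «no hypothesis on K»; leaf list §L2).  The kernel `Ψ̂_{(x,α),(y,β)} := (Ψ_m e_{(β,y)})_α(x)` of `CompositeCorrectorKernel`
represents `Ψ_m` on columns of an arbitrary kernel only because `A ↦ (Ψ_m A)_α(x)` is ℝ-LINEAR (this file) and reads finitely many bonds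
(`CompositeCorrectorLocality`): then `Ψ_m A = Σ_{(β,y)} (Ψ_m e_{(β,y)}) · A_β(y)`, a finite sum.

WHAT (`d` the lattice dimension; `L` the block side, `m` levels, `n = L^m`; roots `r : ℕ → (Fin d → ℕ)`; all [folklore]):
§1 letter sums: `axial_sum_smul`, `segUp_sum_smul`, `treeGaugeAt_smul ∕ _smul'`, `gammaCAt_sum_smul`, `linAvgAt_smul` (real coefficients; an3's
   `RootedJetDictionary.linAvgAt_smul` is the normed-algebra-valued twin, not imported here), `blockSum_add ∕ _smul`.
§2 `compLinAvgAt_add ∕ _smul`, `compDefectAt_add ∕ _zero' ∕ _smul`.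
§3 `corrPsi_apply ∕ corrPhi_apply` (pointwise: `(Ψ_m A)_α(x) = A_α(x) + |box n|⁻¹·(ζ_m A (blk n (x + e_α)) − ζ_m A (blk n x))`), `corrPsi_add ∕ _smul ∕ _zero ∕ _sum_smul`,
   `corrPhi_add ∕ _smul ∕ _zero ∕ _sum_smul`.
Provenance: β sub-cell; cross-lane idle seat `b2b-balaban-t4-ne9-formalise-leaf-06` gen 32 (prover-b2b-balaban-t4-ne9-formalise-leaf-06-g32-0), 2026-08-21, on the
row-D1 owner's K-U3d leaf list (INTENT journal l.23693, SHAPE l.23754).  NOT (SDF), NOT D1, NOT `BetaPertH`, NOT continuum, NOT Clay.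
-/

namespace Summit.QuantumFields.BalabanUV.Beta.CompositeCorrectorLinear

open Finset
open scoped BigOperators
open Literature.MathematicalPhysics.QuantumFieldTheory.Balaban1983to89.Beta
open AffineAveraging (Site Form0 Form1 box toSite unitVec unitVec_apply dz blockSum)
open AveragingContours (blk axial segUp rev rev_sum)
open AveragingContoursRooted (linAvgAt treeGaugeAt gammaCAt)
open AxialProjector (axial_map segUp_map)
open Summit.QuantumFields.BalabanUV.Beta.CompositeAveragingCoarseExact (compLinAvgAt compDefectAt compLinAvgAt_succ compDefectAt_succ
  compLinAvgAt_zero compDefectAt_zero)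
open Summit.QuantumFields.BalabanUV.Beta.CompositeCorrectorForms (ext ext_apply corrPhi corrPsi compLinAvgAt_sub compDefectAt_sub)

noncomputable section

variable {d : ℕ}

/-! ## §1 Letter sums are ℝ-homogeneous -/

/-- [folklore] The axial contour sum is ℝ-homogeneous in the field. -/
theorem axial_sum_smul (c : ℝ) (A : Form1 d ℝ) (y x : Site d) : (axial (c • A) y x).sum = c * (axial A y x).sum := by
  have e : (c • A : Form1 d ℝ) = fun κ z => AddMonoidHom.mulLeft c (A κ z) := by
    funext κ z; simp only [Pi.smul_apply, smul_eq_mul, AddMonoidHom.coe_mulLeft]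
  rw [e, axial_map, ← map_list_sum]
  rfl

/-- [folklore] The straight segment sum is ℝ-homogeneous in the field. -/
theorem segUp_sum_smul (c : ℝ) (A : Form1 d ℝ) (z : Site d) (κ : Fin d) (n : ℕ) :
    (segUp (c • A) z κ n).sum = c * (segUp A z κ n).sum := by
  have e : (c • A : Form1 d ℝ) = fun κ z => AddMonoidHom.mulLeft c (A κ z) := by
    funext κ z; simp only [Pi.smul_apply, smul_eq_mul, AddMonoidHom.coe_mulLeft]
  rw [e, segUp_map, ← map_list_sum]
  rfl

/-- [folklore] The rooted tree integral is ℝ-homogeneous in the field. -/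
theorem treeGaugeAt_smul (c : ℝ) (ρ : Site d) (A : Form1 d ℝ) (L : ℕ) (x : Site d) :
    treeGaugeAt ρ (c • A) L x = c * treeGaugeAt ρ A L x := by
  unfold treeGaugeAt
  exact axial_sum_smul c A _ x

/-- [folklore] … as an identity of 0-forms. -/
theorem treeGaugeAt_smul' (c : ℝ) (ρ : Site d) (A : Form1 d ℝ) (L : ℕ) : treeGaugeAt ρ (c • A) L = c • treeGaugeAt ρ A L := by
  funext x
  rw [Pi.smul_apply, smul_eq_mul]
  exact treeGaugeAt_smul c ρ A L x

/-- [folklore] The rooted contour sum `A(Γ^ρ_{c,x})` is ℝ-homogeneous in the field. -/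
theorem gammaCAt_sum_smul (c : ℝ) (ρ : Site d) (A : Form1 d ℝ) (L : ℕ) (μ : Fin d) (y : Site d) (b : Fin d → ℕ) :
    (gammaCAt ρ (c • A) L μ y b).sum = c * (gammaCAt ρ A L μ y b).sum := by
  simp only [gammaCAt, List.sum_append, rev_sum, axial_sum_smul, segUp_sum_smul]
  ring

/-- [folklore] The rooted linear average is ℝ-homogeneous in the field (real coefficients; cf. an3's `RootedJetDictionary.linAvgAt_smul`). -/
theorem linAvgAt_smul (c : ℝ) (ρ : Site d) (A : Form1 d ℝ) (L : ℕ) (μ : Fin d) (y : Site d) :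
    linAvgAt ρ (c • A) L μ y = c * linAvgAt ρ A L μ y := by
  simp only [linAvgAt, gammaCAt_sum_smul, Finset.mul_sum]

/-- [folklore] `blockSum` is additive (real 0-forms). -/
theorem blockSum_add (L : ℕ) (f g : Form0 d ℝ) : blockSum L (f + g) = blockSum L f + blockSum L g := by
  funext y; simp only [blockSum, Pi.add_apply, Finset.sum_add_distrib]

/-- [folklore] `blockSum` is ℝ-homogeneous (real 0-forms). -/
theorem blockSum_smul (L : ℕ) (c : ℝ) (f : Form0 d ℝ) : blockSum L (c • f) = c • blockSum L f := by
  funext y; simp only [blockSum, Pi.smul_apply, smul_eq_mul, Finset.mul_sum]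

/-! ## §2 The composite average and the defect potential -/

/-- [folklore] **THE COMPOSITE IS ADDITIVE** (from L1's subtractivity). -/
theorem compLinAvgAt_add (r : ℕ → (Fin d → ℕ)) (L m : ℕ) (A B : Form1 d ℝ) :
    compLinAvgAt r L m (A + B) = compLinAvgAt r L m A + compLinAvgAt r L m B := by
  have h := compLinAvgAt_sub r L (A + B) B m
  rw [add_sub_cancel_right] at h
  rw [h, sub_add_cancel]

/-- [folklore] **THE COMPOSITE IS ℝ-HOMOGENEOUS.** -/
theorem compLinAvgAt_smul (r : ℕ → (Fin d → ℕ)) (L : ℕ) (c : ℝ) (A : Form1 d ℝ) :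
    ∀ m, compLinAvgAt r L m (c • A) = c • compLinAvgAt r L m A
  | 0 => rfl
  | m + 1 => by
      rw [compLinAvgAt_succ, compLinAvgAt_succ, compLinAvgAt_smul r L c A m]
      funext μ y
      rw [Pi.smul_apply, Pi.smul_apply, smul_eq_mul]
      exact linAvgAt_smul c _ _ L μ y

/-- [folklore] **THE DEFECT POTENTIAL IS ADDITIVE** (from L1's subtractivity). -/
theorem compDefectAt_add (r : ℕ → (Fin d → ℕ)) (L m : ℕ) (A B : Form1 d ℝ) :
    compDefectAt r L m (A + B) = compDefectAt r L m A + compDefectAt r L m B := by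
  have h := compDefectAt_sub r L (A + B) B m
  rw [add_sub_cancel_right] at h
  rw [h, sub_add_cancel]

/-- [folklore] The defect potential of the zero field vanishes. -/
theorem compDefectAt_zero' (r : ℕ → (Fin d → ℕ)) (L m : ℕ) : compDefectAt r L m (0 : Form1 d ℝ) = 0 := by
  have h := compDefectAt_sub r L (0 : Form1 d ℝ) 0 m
  rwa [sub_self, sub_self] at h

/-- [folklore] **THE DEFECT POTENTIAL IS ℝ-HOMOGENEOUS.** -/
theorem compDefectAt_smul (r : ℕ → (Fin d → ℕ)) (L : ℕ) (c : ℝ) (A : Form1 d ℝ) :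
    ∀ m, compDefectAt r L m (c • A) = c • compDefectAt r L m A
  | 0 => by rw [compDefectAt_zero, compDefectAt_zero, smul_zero]
  | m + 1 => by
      rw [compDefectAt_succ, compDefectAt_succ, compDefectAt_smul r L c A m, compLinAvgAt_smul, treeGaugeAt_smul', ← smul_add,
        blockSum_smul]

/-! ## §3 The correctors -/

/-- [folklore] **THE CORRECTOR `Ψ_m`, POINTWISE**: `(Ψ_m A)_α(x) = A_α(x) + |box n|⁻¹·(ζ_m A (blk n (x + e_α)) − ζ_m A (blk n x))`, `n = L^m`. -/
theorem corrPsi_apply (r : ℕ → (Fin d → ℕ)) (L m : ℕ) (A : Form1 d ℝ) (α : Fin d) (x : Site d) :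
    corrPsi r L m A α x
      = A α x + ((box d (L ^ m)).card : ℝ)⁻¹ *
          (compDefectAt r L m A (blk (L ^ m) (x + unitVec α)) - compDefectAt r L m A (blk (L ^ m) x)) := by
  simp only [corrPsi, Pi.add_apply, Pi.smul_apply, smul_eq_mul, dz, ext_apply]

/-- [folklore] **THE CORRECTOR `Φ_m`, POINTWISE**: `(Φ_m A)_α(x) = A_α(x) − |box n|⁻¹·(ζ_m A (blk n (x + e_α)) − ζ_m A (blk n x))`. -/
theorem corrPhi_apply (r : ℕ → (Fin d → ℕ)) (L m : ℕ) (A : Form1 d ℝ) (α : Fin d) (x : Site d) :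
    corrPhi r L m A α x
      = A α x - ((box d (L ^ m)).card : ℝ)⁻¹ *
          (compDefectAt r L m A (blk (L ^ m) (x + unitVec α)) - compDefectAt r L m A (blk (L ^ m) x)) := by
  simp only [corrPhi, Pi.sub_apply, Pi.smul_apply, smul_eq_mul, dz, ext_apply]

/-- [folklore] `Ψ_m` is additive. -/
theorem corrPsi_add (r : ℕ → (Fin d → ℕ)) (L m : ℕ) (A B : Form1 d ℝ) :
    corrPsi r L m (A + B) = corrPsi r L m A + corrPsi r L m B := by
  funext α x
  simp only [corrPsi_apply, Pi.add_apply, compDefectAt_add]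
  ring

/-- [folklore] `Ψ_m` is ℝ-homogeneous. -/
theorem corrPsi_smul (r : ℕ → (Fin d → ℕ)) (L m : ℕ) (c : ℝ) (A : Form1 d ℝ) :
    corrPsi r L m (c • A) = c • corrPsi r L m A := by
  funext α x
  simp only [corrPsi_apply, Pi.smul_apply, smul_eq_mul, compDefectAt_smul]
  ring

/-- [folklore] `Ψ_m 0 = 0`. -/
theorem corrPsi_zero (r : ℕ → (Fin d → ℕ)) (L m : ℕ) : corrPsi r L m (0 : Form1 d ℝ) = 0 := by
  funext α x
  simp only [corrPsi_apply, Pi.zero_apply, compDefectAt_zero', sub_self, mul_zero, add_zero]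

/-- [folklore] `Ψ_m` on a finite linear combination. -/
theorem corrPsi_sum_smul {ι : Type*} (r : ℕ → (Fin d → ℕ)) (L m : ℕ) (s : Finset ι) (c : ι → ℝ) (B : ι → Form1 d ℝ) :
    corrPsi r L m (∑ i ∈ s, c i • B i) = ∑ i ∈ s, c i • corrPsi r L m (B i) := by
  classical
  induction s using Finset.induction_on with
  | empty => rw [Finset.sum_empty, Finset.sum_empty, corrPsi_zero]
  | insert i s hi ih => rw [Finset.sum_insert hi, Finset.sum_insert hi, corrPsi_add, corrPsi_smul, ih]

/-- [folklore] `Φ_m` is additive. -/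
theorem corrPhi_add (r : ℕ → (Fin d → ℕ)) (L m : ℕ) (A B : Form1 d ℝ) :
    corrPhi r L m (A + B) = corrPhi r L m A + corrPhi r L m B := by
  funext α x
  simp only [corrPhi_apply, Pi.add_apply, compDefectAt_add]
  ring

/-- [folklore] `Φ_m` is ℝ-homogeneous. -/
theorem corrPhi_smul (r : ℕ → (Fin d → ℕ)) (L m : ℕ) (c : ℝ) (A : Form1 d ℝ) :
    corrPhi r L m (c • A) = c • corrPhi r L m A := by
  funext α x
  simp only [corrPhi_apply, Pi.smul_apply, smul_eq_mul, compDefectAt_smul]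
  ring

/-- [folklore] `Φ_m 0 = 0`. -/
theorem corrPhi_zero (r : ℕ → (Fin d → ℕ)) (L m : ℕ) : corrPhi r L m (0 : Form1 d ℝ) = 0 := by
  funext α x
  simp only [corrPhi_apply, Pi.zero_apply, compDefectAt_zero', sub_self, mul_zero]

/-- [folklore] `Φ_m` on a finite linear combination. -/
theorem corrPhi_sum_smul {ι : Type*} (r : ℕ → (Fin d → ℕ)) (L m : ℕ) (s : Finset ι) (c : ι → ℝ) (B : ι → Form1 d ℝ) :
    corrPhi r L m (∑ i ∈ s, c i • B i) = ∑ i ∈ s, c i • corrPhi r L m (B i) := by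
  classical
  induction s using Finset.induction_on with
  | empty => rw [Finset.sum_empty, Finset.sum_empty, corrPhi_zero]
  | insert i s hi ih => rw [Finset.sum_insert hi, Finset.sum_insert hi, corrPhi_add, corrPhi_smul, ih]

end

end Summit.QuantumFields.BalabanUV.Beta.CompositeCorrectorLinear
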